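import Mathlib
import HarnessLib

/-!
# Barrier: in an infinite-dimensional normed space NO closed ball (and no set containing one) is
# compact (F. Riesz) — «X is bounded and closed, hence compact» cannot feed Schauder / Krasnosel'skii /
# Schaefer fixed-point theorems in function spaces

Catalogue entry (kind (c), method-level lemma; cell ns-claims, D-0090; technique row «fixed-point
existence schemes (Schauder, Krasnosel'skii expansive-sum, Schaefer / Leray–Schauder) in function spaces
with compactness taken from boundedness»), salvage seat ns-claims-salvage-p1. Everything below is PROVED
(Mathlib's Riesz theorem `FiniteDimensional.of_isCompact_closedBall`; polynomial algebra).

THE DEVICE. Rewrite the PDE as a fixed-point problem `u = Tu + Su` (or `u = Su`) on a set `X` of a Banach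
space of functions (`C([0,1], C²₀(D))`, `C¹([0,1], C₀²(D_j))`, weighted `C(ℝ₊ × ℝ³)`, …), take for `X`
(and for the auxiliary `Y ⊃ X`) norm-balls or norm-bounded closed convex sets, and «verify» the
compactness hypothesis of the fixed-point theorem by the sentence «X is closed and bounded, hence compact»
/ «by construction X is a compact subset of Y». In an infinite-dimensional normed space this sentence is
false for EVERY ball of positive radius (F. Riesz 1918) [cite: EinsiedlerWard2017, Prop. 2.35]; compact
subsets of `C(K)` are the closed, bounded AND EQUICONTINUOUS ones (Arzelà–Ascoli)
[cite: EinsiedlerWard2017, Thm. 2.38], and equicontinuity (a modulus, a derivative bound one order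
higher, a compact embedding) is exactly the a priori estimate such schemes do not supply.

KERNEL CONTENT.
* `not_isCompact_closedBall` — in a real normed space that is not finite-dimensional, no closed ball of
  positive radius is compact; `not_isCompact_of_closedBall_subset` — no compact set contains a ball (so
  «X ⊂ Y, X a ball, Y compact» is impossible); both from Mathlib's Riesz theorem.
* `not_finiteDimensional_continuousMap_Icc` — the model function space `C([0,1], ℝ)` is not
  finite-dimensional (the monomials restrict injectively: a polynomial vanishing on `[0,1]` is zero), hence
  `not_isCompact_closedBall_continuousMap_Icc`: its closed balls are not compact.
* The cell's refuter lane proved the same for the claim's own cell spaces with an explicit 1-separated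
  smooth sequence (`Summit.NavierStokesRegularity.NavierStokesRegularity.Theorems.GeorgievDavidi2021.not_ballCompact`,
  p479044: `f_n(t,x) = c·β(x)·sin(2π2ⁿ(t−a))/(2π2ⁿ)`), which this entry abstracts.

Cell record: instance under adjudication = claim C31 `GeorgievDavidi2021` (arXiv:1806.10081 v10), typed
skeleton `Literature.Claims.NS.GeorgievDavidi2021` (p474043): «By the construction of X¹ and Y¹, we have
that X¹ is a compact subset of Y¹ and Y¹ is a compact subset of C¹([0,1],C₀²(D_j))» (p.12 l.9–11, `Step4_compact`
/ `Step4Cell`), feeding the expansive Krasnosel'skii theorem of Xiang–Yuan (Thm 2.2–2.3 p.5); the pinned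
journal version (Filomat 38 (2024) 2965–2982, §4: «Note that Y is a compact set in X», Schaefer variant)
uses the same sentence. This entry is the METHOD-level statement; it is independent of, and does not
pre-empt, the cell's verdict of record (posted on the MAP, not here).

WHAT THIS IS NOT: not a claim about NS regularity or blow-up; not a claim about any author beyond the typed
locator.
-/

noncomputable section

open Metric Set

namespace Literature.Barriers.NavierStokesRegularity

namespace NormBallNotCompact

/-- **Riesz: no compact balls in infinite dimensions.** In a real normed space that is not
finite-dimensional, no closed ball of positive radius is compact. [cite: EinsiedlerWard2017, Prop. 2.35] -/
theorem not_isCompact_closedBall {V : Type*} [NormedAddCommGroup V] [NormedSpace ℝ V]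
    (hV : ¬ FiniteDimensional ℝ V) (c : V) {r : ℝ} (hr : 0 < r) : ¬ IsCompact (closedBall c r) :=
  fun h => hV (FiniteDimensional.of_isCompact_closedBall ℝ hr h)

/-- **No compact set contains a ball**: if `closedBall c r ⊆ Y` with `r > 0` and `Y` compact, the space is
finite-dimensional — so «X ⊂ Y with X a norm-ball (or any set with interior) and Y compact» is impossible in
every infinite-dimensional function space. [cite: EinsiedlerWard2017, Prop. 2.35] -/
theorem not_isCompact_of_closedBall_subset {V : Type*} [NormedAddCommGroup V] [NormedSpace ℝ V]
    (hV : ¬ FiniteDimensional ℝ V) {Y : Set V} {c : V} {r : ℝ} (hr : 0 < r) (hY : closedBall c r ⊆ Y) :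
    ¬ IsCompact Y :=
  fun h => not_isCompact_closedBall hV c hr (h.of_isClosed_subset isClosed_closedBall hY)

/-- **The model function space `C([0,1], ℝ)` is infinite-dimensional**: restriction of polynomials
`ℝ[X] → C([0,1], ℝ)` is an injective linear map (a polynomial vanishing on the infinite set `[0,1]` is `0`),
and `ℝ[X]` has the infinite linearly independent family of monomials. [cite: EinsiedlerWard2017, §2.3 (the space C(X))] -/
theorem not_finiteDimensional_continuousMap_Icc :
    ¬ FiniteDimensional ℝ C(Icc (0 : ℝ) 1, ℝ) := by
  intro hfin
  set Φ : Polynomial ℝ →ₐ[ℝ] C(Icc (0 : ℝ) 1, ℝ) := Polynomial.toContinuousMapOnAlgHom (Icc (0 : ℝ) 1)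
  have hinj : Function.Injective Φ.toLinearMap := by
    intro p q hpq
    have h0 : Φ (p - q) = 0 := by rw [map_sub]; exact sub_eq_zero.2 hpq
    have hroots : ∀ x ∈ Icc (0 : ℝ) 1, (p - q).IsRoot x := by
      intro x hx
      have := congrArg (fun f : C(Icc (0 : ℝ) 1, ℝ) => f ⟨x, hx⟩) h0
      simpa [Φ, Polynomial.IsRoot] using this
    have hinf : Set.Infinite {x : ℝ | (p - q).IsRoot x} :=
      (Set.Icc_infinite (zero_lt_one' ℝ)).mono fun x hx => hroots x hx
    exact sub_eq_zero.1 ((p - q).eq_zero_of_infinite_isRoot hinf)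
  haveI : Module.Finite ℝ (Polynomial ℝ) := Module.Finite.of_injective Φ.toLinearMap hinj
  exact Module.Finite.not_linearIndependent_of_infinite _ (Polynomial.basisMonomials ℝ).linearIndependent

/-- **The closed balls of `C([0,1], ℝ)` are not compact** (Riesz; e.g. `fₙ(x) = xⁿ`, or 1-separated
bumps, have no uniformly convergent subsequence). [cite: EinsiedlerWard2017, Prop. 2.35 and §2.3] -/
theorem not_isCompact_closedBall_continuousMap_Icc (c : C(Icc (0 : ℝ) 1, ℝ)) {r : ℝ} (hr : 0 < r) :
    ¬ IsCompact (closedBall c r) :=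
  not_isCompact_closedBall not_finiteDimensional_continuousMap_Icc c hr

end NormBallNotCompact

open NormBallNotCompact

/-- **Barrier (method-level lemma): «closed and bounded, hence compact» is false in every
infinite-dimensional normed space — no closed ball of positive radius, and no set containing one, is
compact; in particular in the function space `C([0,1], ℝ)`.**

BARRIER (structured block, D-0021):
technique_class: schauder-fixed-point krasnoselskii-expansive-sum schaefer-leray-schauder fixed-point-in-function-space compactness-from-boundedness closed-bounded-hence-compact integral-operator-reformulation
blocks: existence schemes for NavierStokesRegularity (and for «any evolution PDE») that rewrite the Cauchy problem cell-by-cell or globally as `u = Tu + Su` / `u = Su` on a norm-ball or norm-bounded closed convex set `X` (inside an auxiliary `Y`) of an infinite-dimensional Banach space of functions and take the compactness hypothesis of Schauder / Krasnosel'skii (expansive sum, Xiang–Yuan 2009 Thm 2.4) / Schaefer from the sentence «X is closed and bounded (by construction), hence compact» or «Y is a compact set containing X»; instance under adjudication C31 `GeorgievDavidi2021` p.12 l.9–11 «X¹ is a compact subset of Y¹ and Y¹ is a compact subset of C¹([0,1],C₀²(D_j))» (`Literature.Claims.NS.GeorgievDavidi2021.Step4_compact` / `Step4Cell`; refuter lane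 `….Theorems.GeorgievDavidi2021.not_ballCompact`, `not_Step4Cell` p479044, `not_Step4_compact`) and its journal variant Filomat 38 (2024) §4 («Note that Y is a compact set in X») [cite: GeorgievDavidi2018, p.12 l.9–11; Thm 2.2–2.3 p.5].
because: F. Riesz: a normed space whose closed unit ball is compact is finite-dimensional [cite: EinsiedlerWard2017, Prop. 2.35] (Mathlib `FiniteDimensional.of_isCompact_closedBall`) — kernel `not_isCompact_closedBall`, `not_isCompact_of_closedBall_subset`; function spaces of the kind used are infinite-dimensional — kernel `not_finiteDimensional_continuousMap_Icc` (polynomials restrict injectively to `[0,1]`), `not_isCompact_closedBall_continuousMap_Icc`; the honest compactness criterion in `C(K)` is Arzelà–Ascoli (closed + bounded + EQUICONTINUOUS) [cite: EinsiedlerWard2017, Thm. 2.38], and equicontinuity of the image of the solution operator is an a priori estimate one derivative higher — the regularity information the scheme was meant to produce.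
evasions_known: (a) genuine compactness: `S(X)` relatively compact because `S` gains derivatives (smoothing integral operators: heat/Stokes kernels on bounded time intervals, compact Sobolev/Hölder embeddings on bounded domains) — this is the classical LOCAL existence theory (Leray–Schauder degree for steady NS, Fujita–Kato/Kato for the Cauchy problem) and yields local or small-data results, not global regularity; (b) weak/weak-* compactness of balls (Banach–Alaoglu) gives weak solutions (Leray–Hopf), whose regularity and uniqueness are exactly what is at stake; (c) finite-dimensional truncations (Galerkin) have compact balls, and the passage to the limit needs the uniform estimates again.
scope_caveats: (i) the kernel statements are Riesz's theorem (abstract) and the infinite-dimensionality of `C([0,1],ℝ)`; the claim's own cell spaces are handled by the refuter's explicit 1-separated sequence (p479044), not re-proved here; (ii) the entry refutes «bounded ⇒ compact» and «ball inside a compact set», nothing about schemes that verify equicontinuity honestly; (iii) says nothing about NS blow-up or regularity.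
status: established (proved here; Mathlib Riesz theorem)
[cite: EinsiedlerWard2017, Prop. 2.35, Thm. 2.38] -/
def NormBallNotCompact : Prop :=
  (∀ (V : Type) [NormedAddCommGroup V] [NormedSpace ℝ V], ¬ FiniteDimensional ℝ V →
      ∀ (c : V) (r : ℝ), 0 < r → ¬ IsCompact (closedBall c r)) ∧
  (∀ (V : Type) [NormedAddCommGroup V] [NormedSpace ℝ V], ¬ FiniteDimensional ℝ V →
      ∀ (Y : Set V) (c : V) (r : ℝ), 0 < r → closedBall c r ⊆ Y → ¬ IsCompact Y) ∧
  ¬ FiniteDimensional ℝ C(Icc (0 : ℝ) 1, ℝ) ∧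
  ∀ (c : C(Icc (0 : ℝ) 1, ℝ)) (r : ℝ), 0 < r → ¬ IsCompact (closedBall c r)

/-- Discharge of the barrier statement. [cite: EinsiedlerWard2017, Prop. 2.35] -/
theorem normBallNotCompact_holds : NormBallNotCompact :=
  ⟨fun _ _ _ hV c _ hr => not_isCompact_closedBall hV c hr,
    fun _ _ _ hV _ _ _ hr hY => not_isCompact_of_closedBall_subset hV hr hY,
    not_finiteDimensional_continuousMap_Icc,
    fun c _ hr => not_isCompact_closedBall_continuousMap_Icc c hr⟩

end Literature.Barriers.NavierStokesRegularity

end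

-- WHAT THIS IS NOT: not a claim about NS regularity or blow-up; not a claim about any author beyond the typed locator.
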